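import Literature.AlgebraicGeometry.Resolution.AlterationsSingFitting
import Literature.AlgebraicGeometry.Resolution.SmoothFibreCriterionPointwise
import Literature.AlgebraicGeometry.Resolution.NodalCurveSmoothLocus
import Literature.AlgebraicGeometry.Resolution.SemiStableCurvesDimension
import Literature.AlgebraicGeometry.Resolution.OrdinaryDoublePointReduced
import Literature.AlgebraicGeometry.Resolution.SmoothLocusBaseChange
import Mathlib.AlgebraicGeometry.Morphisms.Smooth
import Mathlib.AlgebraicGeometry.Morphisms.FiniteType
import Mathlib.FieldTheory.IsAlgClosed.AlgebraicClosure
import HarnessLib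

/-!
# The smooth locus of a semi-stable curve is the complement of `Sing(f)` (de Jong 1996, 3.1; Stacks 01V9) — proof

Topic: `Literature/AlgebraicGeometry/Resolution`. Discharges the named fact
`DeJong1996SmoothIffDifferentialsCyclic` of `AlterationsSingFitting.lean` — de Jong 1996, 3.1:
"Assume we have a semi-stable curve `f : X → S` smooth over `S ∖ D`. We remark that the singular
locus `Sing(X)` of the scheme `X` is contained in `Sing(f)`", with 2.21: "Let `Sing(f) ⊂ X` be the
closed subscheme defined by the first Fitting ideal of the sheaf `Ω_{X/S}`"; rendered as the
differential criterion The Stacks Project, Tag 01V9 (1) ⇔ (3) ("`f` is smooth at `x`" iff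
"`𝒪_{S,s} → 𝒪_{X,x}` is flat and the `𝒪_{X,x}`-module `Ω_{X/S,x}` can be generated by at most
`dim_x(X_{f(x)})` elements") for a semi-stable curve, where `f` is flat and `dim_x(X_s) = 1`:
for every `x ∈ X`, `f` is smooth on a neighbourhood of `x` iff `Ω_{𝒪_{X,x}/𝒪_{S,f x}}` is cyclic.
Everything is PROVED:

* `isSmoothAt_iff_not_fittingIdeal_kaehlerDifferential_le` — **the ring form** for a flat
  finitely presented `R → T`, a prime `𝔮` over `𝔭`, and an algebraically closed algebraic
  extension `K ⊇ κ(𝔭)` such that the geometric fibre ring `K ⊗_R T` is nodal-or-regular at its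
  maximal ideals: `T` is `R`-smooth at `𝔮` iff `Fitt₁(Ω_{T/R}) ⊄ 𝔮`. Assembled from the fibre
  criterion and the descent along `κ(𝔭) → K` (`SmoothFibreCriterionPointwise.lean`) and the
  computation over `K = K̄` (`NodalCurveSmoothLocus.lean`), through
  `K ⊗_{κ(𝔭)} (κ(𝔭) ⊗_R T) ≅ K ⊗_R T`.
* `IsSemiStableCurve.isRegularLocalRing_or_node_localization` — **the hypothesis holds for a
  semi-stable curve** (de Jong 1996, 2.21: "all geometric fibres are connected curves having at
  most ordinary double points as singularities"): for affine opens `V ⊆ f⁻¹U` and `K = K̄` under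
  `Γ(S, U)`, the canonical open immersion `Spec (K ⊗_{Γ(S,U)} Γ(X,V)) ↪ X ×_S Spec K`
  identifies `(K ⊗ Γ(X,V))_𝔪`, `𝔪` maximal, with the local ring of the
  geometric fibre at a closed point (the fibre is Jacobson), which 2.21 makes regular of
  dimension `1` or an ordinary double point (dimension `1`, `SemiStableCurvesDimension.lean`;
  reduced, `OrdinaryDoublePointReduced.lean`; not regular, the completion `K⟦u, v⟧/(uv)` not being
  a domain).
* `DeJong1996SmoothIffDifferentialsCyclic_holds` — THE DISCHARGE: on affine charts
  `f x ∈ U = Spec R`, `x ∈ V = Spec T ⊆ f⁻¹U`, `x ↔ 𝔮`, the left side is "`T` is `R`-smooth at `𝔮`"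
  (Mathlib `formallySmooth_stalkMap_iff`), the right side is `Fitt₁(Ω_{𝒪_{X,x}/𝒪_{S,f x}}) = (1)`
  (Stacks 07ZC over the local ring), i.e. `Fitt₁(Ω_{T/R}) ⊄ 𝔮` (Fitting ideals and differentials
  commute with the localizations `𝒪_{S,f x} = R_𝔭 → 𝒪_{X,x} = T_𝔮`).

## Sources

* A. J. de Jong, *Smoothness, semi-stability and alterations*, Publ. Math. IHÉS 83 (1996), 2.21
  (p. 61), 3.1 (p. 62). [DeJong1996]
* The Stacks Project, Tags 01V9, 0C3K, 07ZC, 00TF, 02VL, 0C4D. [StacksProject]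
-/

noncomputable section

open CategoryTheory CategoryTheory.Limits AlgebraicGeometry TopologicalSpace IsLocalRing TensorProduct

namespace Literature.AlgebraicGeometry.Resolution

open Literature.RingTheory.FittingIdeal

universe u

/-! ## The ring form: assembly of the fibre criterion, the descent and the nodal computation -/

section Assembly

variable {R : Type u} {T : Type u} [CommRing R] [CommRing T] [Algebra R T]

set_option backward.isDefEq.respectTransparency false in
/-- **Stacks 01V9 (1) ⇔ (3) with 0C3K, ring form, for families with at worst nodal geometric
fibres.** Let `T` be flat and of finite presentation over `R`, `p ⊂ R` a prime, `q'` a prime of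
the fibre ring `κ(p) ⊗_R T` over the prime `q = q' ∩ T`, and `K ⊇ κ(p)` an algebraically closed
algebraic extension such that the geometric fibre ring `K ⊗_R T` has, at every maximal ideal,
a local ring which is regular of dimension `1` or an ordinary double point (dimension `1`,
reduced, not regular, completion `K⟦u, v⟧/(uv)`). Then `T` is `R`-smooth at `q` iff
`Fitt₁(Ω_{T/R}) ⊄ q` — "`f` is smooth at `x`" iff "`Ω_{X/S,x}` can be generated by at most
`dim_x(X_{f(x)})` [`= 1`] elements" (Stacks 01V9 (1) ⇔ (3)), i.e. iff
`x ∉ Sing(f) = V(Fitt₁ Ω_{X/S})` (de Jong 1996, 2.21; Stacks 0C3K). Proof: smoothness at `q` is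
smoothness of the fibre at `q'` (`isSmoothAt_comap_iff_isSmoothAt_fiber`), which is smoothness
of the geometric fibre `K ⊗_{κ(p)} (κ(p) ⊗_R T) ≅ K ⊗_R T` at the primes over `q'`
(`isSmoothAt_iff_forall_isSmoothAt_baseChange`), which is `Fitt₁ ⊄ ·` there
(`isSmoothAt_iff_not_fittingIdeal_le_of_isAlgClosed`); and `Fitt₁(Ω)` commutes with both base
changes. [cite: StacksProject, Tag 01V9] -/
theorem isSmoothAt_iff_not_fittingIdeal_kaehlerDifferential_le
    [Algebra.FinitePresentation R T] [Module.Flat R T]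
    (p : Ideal R) [p.IsPrime] (q' : Ideal (p.ResidueField ⊗[R] T)) [q'.IsPrime]
    (K : Type u) [Field K] [IsAlgClosed K] [Algebra R K] [Algebra p.ResidueField K]
    [IsScalarTower R p.ResidueField K] [Algebra.IsAlgebraic p.ResidueField K]
    (HG : ∀ (m : Ideal (K ⊗[R] T)) [m.IsMaximal],
      (IsRegularLocalRing (Localization.AtPrime m) ∧
          ringKrullDim (Localization.AtPrime m) = 1) ∨
        (ringKrullDim (Localization.AtPrime m) = 1 ∧ IsReduced (Localization.AtPrime m) ∧
          ¬ IsRegularLocalRing (Localization.AtPrime m) ∧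
          Nonempty (AdicCompletion (maximalIdeal (Localization.AtPrime m))
              (Localization.AtPrime m) ≃+*
            MvPowerSeries (Fin 2) K ⧸
              Ideal.span {(MvPowerSeries.X 0 * MvPowerSeries.X 1 : MvPowerSeries (Fin 2) K)}))) :
    Algebra.IsSmoothAt R (q'.comap (Algebra.TensorProduct.includeRight :
        T →ₐ[R] p.ResidueField ⊗[R] T)) ↔
      ¬ Module.fittingIdeal T Ω[T⁄R] 1 ≤
        q'.comap (Algebra.TensorProduct.includeRight : T →ₐ[R] p.ResidueField ⊗[R] T) := by
  let κ := p.ResidueField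
  let F := κ ⊗[R] T
  haveI : Algebra.FiniteType κ F := inferInstance
  -- the geometric fibre `K ⊗_κ F ≅ K ⊗_R T` and the hypothesis transported to it
  let eG : K ⊗[κ] F ≃ₐ[K] K ⊗[R] T := Algebra.TensorProduct.cancelBaseChange R κ K K T
  have key : ∀ (Q : Ideal (K ⊗[κ] F)) [Q.IsPrime],
      Algebra.IsSmoothAt K Q ↔ ¬ Module.fittingIdeal (K ⊗[κ] F) Ω[K ⊗[κ] F⁄K] 1 ≤ Q := by
    refine isSmoothAt_iff_not_fittingIdeal_le_of_isAlgClosed K (K ⊗[κ] F) (fun m _ => ?_)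
    exact isRegularLocalRing_or_node_of_ringEquiv
      (Localization.nonempty_atPrime_ringEquiv_of_ringEquiv eG.toRingEquiv m).some.symm
      (HG (m.map eG.toRingEquiv))
  rw [isSmoothAt_comap_iff_isSmoothAt_fiber p q',
    ← fittingIdeal_kaehlerDifferential_fiber_le_iff p q' 1,
    isSmoothAt_iff_forall_isSmoothAt_baseChange (K := K) q']
  constructor
  · intro h hJ
    obtain ⟨Q, hQ, hQq⟩ := exists_isPrime_over_of_baseChange_field (κ := κ) (K := K) q'
    haveI := hQ
    have h1 := (key Q).mp (h Q hQq)
    rw [fittingIdeal_kaehlerDifferential_baseChange_le_iff Q 1, hQq] at h1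
    exact h1 hJ
  · intro hJ Q _ hQq
    refine (key Q).mpr ?_
    rw [fittingIdeal_kaehlerDifferential_baseChange_le_iff Q 1, hQq]
    exact hJ

end Assembly

/-! ## The local rings of a geometric fibre, at the maximal ideals of an affine chart -/

/-- An ordinary double point is not a regular point (the completion of a regular local ring is
a domain, `K⟦u, v⟧/(uv)` is not). [folklore] -/
theorem IsOrdinaryDoublePoint.not_isRegularLocalRing {K : Type u} [Field K] {C : Scheme.{u}}
    {x : C} (h : IsOrdinaryDoublePoint K x) : ¬ IsRegularLocalRing (C.presheaf.stalk x) := by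
  intro hx
  obtain ⟨e⟩ := h
  haveI := isRegularLocalRing_adicCompletion (C.presheaf.stalk x)
  haveI : IsDomain (AdicCompletion (maximalIdeal (C.presheaf.stalk x)) (C.presheaf.stalk x)) :=
    isDomain_of_isRegularLocalRing _
  exact IsOrdinaryDoublePoint.not_isDomain_quotient K (MulEquiv.isDomain _ e.symm.toMulEquiv)

section GeometricFibre

variable {X S : Scheme.{u}} (f : X ⟶ S) {U : S.Opens} {V : X.Opens} (hVU : V ≤ f ⁻¹ᵁ U)
  (K : Type u) [Field K] [Algebra Γ(S, U) K]

/-- **The local rings of the geometric fibre at the maximal ideals of the chart ring**: for a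
semi-stable curve `f : X → S` (de Jong 1996, 2.21: "all geometric fibres are connected curves
having at most ordinary double points as singularities"), affine opens `V ⊆ f⁻¹U` and an
algebraically closed field `K` under `Γ(S, U)` — the geometric point
`s̄ : Spec K → Spec Γ(S, U) = U ⊆ S` — the localization of `G = K ⊗_{Γ(S,U)} Γ(X,V)` at a maximal
ideal `𝔪` is the local ring of the geometric fibre `X ×_S Spec K` at a CLOSED point: the canonical
open immersion `Spec G = V ×_U Spec K ↪ X ×_S Spec K` (`pullback.map` along the open immersions
`V ↪ X`, `U ↪ S`) sends the closed point `𝔪` to a closed point (the fibre, locally of finite type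
over `K`, is Jacobson) with the same local ring. Hence, by 2.21, `G_𝔪` is regular of dimension
`1` or an ordinary double point — recorded through its ring-theoretic invariants: dimension `1`
(`IsOrdinaryDoublePoint.ringKrullDim_eq_one`), reduced (`IsOrdinaryDoublePoint.isReduced`), not
regular (the completion `K⟦u, v⟧/(uv)` is not a domain), completion `K⟦u, v⟧/(uv)`.
[cite: DeJong1996, 2.21, p. 61] -/
theorem IsSemiStableCurve.isRegularLocalRing_or_node_localization [IsAlgClosed K]
    (hf : IsSemiStableCurve f) (hU : IsAffineOpen U) (hV : IsAffineOpen V) :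
    letI := (f.appLE U V hVU).hom.toAlgebra
    ∀ (m : Ideal (K ⊗[Γ(S, U)] Γ(X, V))) [m.IsMaximal],
      (IsRegularLocalRing (Localization.AtPrime m) ∧
          ringKrullDim (Localization.AtPrime m) = 1) ∨
        (ringKrullDim (Localization.AtPrime m) = 1 ∧ IsReduced (Localization.AtPrime m) ∧
          ¬ IsRegularLocalRing (Localization.AtPrime m) ∧
          Nonempty (AdicCompletion (maximalIdeal (Localization.AtPrime m))
              (Localization.AtPrime m) ≃+*
            MvPowerSeries (Fin 2) K ⧸
              Ideal.span {(MvPowerSeries.X 0 * MvPowerSeries.X 1 : MvPowerSeries (Fin 2) K)})) := by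
  letI := (f.appLE U V hVU).hom.toAlgebra
  intro m _
  haveI := hf.locallyOfFiniteType
  let G : Type u := K ⊗[Γ(S, U)] Γ(X, V)
  -- the geometric point `s̄ : Spec K → U ⊆ S` and the geometric fibre `P = X ×_S Spec K`
  let sbar : Spec (.of K) ⟶ S := Spec.map (CommRingCat.ofHom (algebraMap Γ(S, U) K)) ≫ hU.fromSpec
  let P : Scheme.{u} := pullback f sbar
  -- the chart `Spec G = V ×_U Spec K ↪ X ×_S Spec K`, an open immersion
  let j : Spec (.of G) ⟶ P :=
    (pullbackSpecIso Γ(S, U) K Γ(X, V)).inv ≫ (pullbackSymmetry _ _).hom ≫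
      pullback.map (Spec.map (CommRingCat.ofHom (algebraMap Γ(S, U) Γ(X, V))))
        (Spec.map (CommRingCat.ofHom (algebraMap Γ(S, U) K))) f sbar
        hV.fromSpec (𝟙 _) hU.fromSpec
        (by
          rw [RingHom.algebraMap_toAlgebra, CommRingCat.ofHom_hom]
          exact IsAffineOpen.SpecMap_appLE_fromSpec f hU hV hVU)
        (by rw [Category.id_comp])
  haveI : IsOpenImmersion j := by
    dsimp only [j]
    infer_instance
  haveI : JacobsonSpace P := LocallyOfFiniteType.jacobsonSpace (pullback.snd f sbar)
  haveI : IsLocallyNoetherian P := LocallyOfFiniteType.isLocallyNoetherian (pullback.snd f sbar)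
  -- the closed point `z = j(𝔪)` of the geometric fibre
  let y : Spec (.of G) := (⟨m, inferInstance⟩ : PrimeSpectrum G)
  let z : P := j y
  have hz : IsClosed ({z} : Set P) := by
    apply isClosed_singleton_of_isLocallyClosed_singleton
    have h1 : IsClosed ({y} : Set (Spec (.of G))) :=
      (PrimeSpectrum.isClosed_singleton_iff_isMaximal y).mpr ‹_›
    have h2 := h1.isLocallyClosed.image j.isOpenEmbedding.isInducing
      j.isOpenEmbedding.isOpen_range.isLocallyClosed
    rwa [Set.image_singleton] at h2
  -- its local ring is `G_𝔪`
  letI : Algebra G ((Spec (.of G)).presheaf.stalk y) := StructureSheaf.stalkAlgebra G y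
  haveI : IsLocalization.AtPrime ((Spec (.of G)).presheaf.stalk y) y.asIdeal :=
    StructureSheaf.IsLocalization.to_stalk G y
  let e₁ : (Spec (.of G)).presheaf.stalk y ≃+* Localization.AtPrime m :=
    (IsLocalization.algEquiv m.primeCompl ((Spec (.of G)).presheaf.stalk y)
      (Localization.AtPrime m)).toRingEquiv
  let e₂ : P.presheaf.stalk z ≃+* (Spec (.of G)).presheaf.stalk y :=
    (asIso (j.stalkMap y)).commRingCatIsoToRingEquiv
  let e : P.presheaf.stalk z ≃+* Localization.AtPrime m := e₂.trans e₁
  -- 2.21 at the closed point `z`, transported along `e`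
  refine isRegularLocalRing_or_node_of_ringEquiv e ?_
  rcases hf.isRegularLocalRing_or_isOrdinaryDoublePoint K sbar z hz with ⟨hreg, hdim⟩ | hnode
  · exact Or.inl ⟨hreg, hdim⟩
  · exact Or.inr ⟨hnode.ringKrullDim_eq_one, hnode.isReduced, hnode.not_isRegularLocalRing, hnode⟩

end GeometricFibre

/-! ## The theorem -/

/-- Smoothness at a prime does not depend on how the prime is written. [folklore] -/
theorem Algebra.isSmoothAt_congr {R A : Type*} [CommRing R] [CommRing A] [Algebra R A]
    {I J : Ideal A} [I.IsPrime] [J.IsPrime] (h : I = J) :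
    Algebra.IsSmoothAt R I ↔ Algebra.IsSmoothAt R J := by
  subst h
  exact Iff.rfl

/-- A point of an open `U` on which `U ↪ X → S` is smooth lies in the smooth locus of `f`, and
conversely (Mathlib `exists_smooth_of_formallySmooth_stalk`). [folklore] -/
theorem exists_smooth_ι_comp_iff_mem_smoothLocus {X S : Scheme.{u}} (f : X ⟶ S)
    [LocallyOfFinitePresentation f] (x : X) :
    (∃ U : X.Opens, x ∈ U ∧ Smooth (U.ι ≫ f)) ↔ x ∈ f.smoothLocus := by
  constructor
  · rintro ⟨U, hxU, hU⟩
    have h1 : (U.ι ≫ f).smoothLocus = ⊤ := Scheme.Hom.smoothLocus_eq_top _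
    have h2 : (⟨x, hxU⟩ : U) ∈ U.ι ⁻¹ᵁ f.smoothLocus := by
      rw [Scheme.Hom.preimage_smoothLocus_eq U.ι f, h1]
      trivial
    exact h2
  · exact exists_smooth_ι_comp_of_mem_smoothLocus f

set_option backward.isDefEq.respectTransparency false in
/-- **The smooth locus of a semi-stable curve is the complement of `Sing(f)`** — the named fact
`DeJong1996SmoothIffDifferentialsCyclic` (de Jong 1996, 3.1 with 2.21; The Stacks Project,
Tag 01V9 (1) ⇔ (3): "`f` is smooth at `x`" iff "`𝒪_{S,s} → 𝒪_{X,x}` is flat and the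
`𝒪_{X,x}`-module `Ω_{X/S,x}` can be generated by at most `dim_x(X_{f(x)})` elements", for a
semi-stable curve, where `f` is flat and `dim_x(X_s) = 1`), PROVED: for a semi-stable curve
`f : X → S` and `x ∈ X`, `f` is smooth on an open neighbourhood of `x` iff `Ω_{𝒪_{X,x}/𝒪_{S,f x}}`
is generated by one element.

Proof. Choose affine opens `f x ∈ U = Spec R ⊆ S`, `x ∈ V = Spec T ⊆ f⁻¹U`, `x ↔ 𝔮 ⊂ T` over
`𝔭 ⊂ R`. The left side is `x ∈ sm(X/S)`, i.e. `T` is `R`-smooth at `𝔮` (Mathlib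
`formallySmooth_stalkMap_iff`). The right side is `Fitt₁(Ω_{𝒪_{X,x}/𝒪_{S,f x}}) = 𝒪_{X,x}`
(Stacks 07ZC over the local ring), i.e. — Fitting ideals and differentials commuting with the
localizations `𝒪_{S, f x} = R_𝔭`, `𝒪_{X,x} = T_𝔮` — `Fitt₁(Ω_{T/R}) ⊄ 𝔮`. These agree by the ring
form `isSmoothAt_iff_not_fittingIdeal_kaehlerDifferential_le` (this file, from
`SmoothFibreCriterionPointwise.lean` and `NodalCurveSmoothLocus.lean`:
the fibre criterion of smoothness, descent along `κ(𝔭) → K = κ(𝔭)^alg`, and the computation at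
the closed points of the geometric fibre, regular ⟺ smooth ⟺ `Fitt₁ = (1)`, node ⟹
`𝔪 ⊆ Fitt₁ ≠ (1)`), whose hypothesis on the geometric fibre ring `K ⊗_R T` is de Jong's 2.21 at
the closed points of `X ×_S Spec K` (`IsSemiStableCurve.isRegularLocalRing_or_node_localization`).
(The Stacks Project, Tag 01V9.) [cite: DeJong1996, 3.1, p. 62] -/
theorem DeJong1996SmoothIffDifferentialsCyclic_holds : DeJong1996SmoothIffDifferentialsCyclic.{u} := by
  intro X S f hf x
  haveI := hf.flat
  haveI := hf.locallyOfFinitePresentation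
  haveI := hf.locallyOfFiniteType
  rw [exists_smooth_ι_comp_iff_mem_smoothLocus f x]
  -- affine charts `f x ∈ U ⊆ S`, `x ∈ V ⊆ f⁻¹U`
  obtain ⟨_, ⟨U, hU, rfl⟩, hxU, -⟩ :=
    S.isBasis_affineOpens.exists_subset_of_mem_open (Set.mem_univ (f x)) isOpen_univ
  obtain ⟨_, ⟨V, hV, rfl⟩, hxV, hVU⟩ :=
    X.isBasis_affineOpens.exists_subset_of_mem_open hxU (U.2.preimage f.continuous)
  have hfp := f.finitePresentation_appLE hU hV hVU
  have hflat : (f.appLE U V hVU).hom.Flat :=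
    HasRingHomProperty.appLE @Flat f ‹Flat f› ⟨U, hU⟩ ⟨V, hV⟩ hVU
  algebraize [(f.appLE U V hVU).hom]
  -- the rings and primes
  set R : Type u := (Γ(S, U) : Type u) with hR
  set T : Type u := (Γ(X, V) : Type u) with hT
  haveI : Module.Flat R T := hflat
  let pt : U := ⟨f x, hVU hxV⟩
  let q : Ideal T := (hV.primeIdealOf ⟨x, hxV⟩).asIdeal
  let p : Ideal R := (hU.primeIdealOf pt).asIdeal
  have hpq : p = q.under R :=
    congr($(IsAffineOpen.comap_primeIdealOf_appLE U hU V hV hVU hxV).1).symm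
  haveI hqp : q.LiesOver p := ⟨hpq⟩
  -- the left side: `T` is `R`-smooth at `q`
  rw [Scheme.Hom.mem_smoothLocus, formallySmooth_stalkMap_iff U hU V hV hVU hxV]
  change Algebra.IsSmoothAt R q ↔ _
  -- the stalks as localizations
  let A := S.presheaf.stalk (f x)
  let B := X.presheaf.stalk x
  letI algAB : Algebra A B := (f.stalkMap x).hom.toAlgebra
  letI : Algebra R A := S.presheaf.algebra_section_stalk pt
  haveI : IsLocalization.AtPrime A p := hU.isLocalization_stalk pt
  letI : Algebra T B := X.presheaf.algebra_section_stalk ⟨x, hxV⟩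
  haveI : IsLocalization.AtPrime B q := hV.isLocalization_stalk ⟨x, hxV⟩
  letI : Algebra R B := ((algebraMap A B).comp (algebraMap R A)).toAlgebra
  haveI : IsScalarTower R A B := IsScalarTower.of_algebraMap_eq (fun _ => rfl)
  haveI : IsScalarTower R T B := IsScalarTower.of_algebraMap_eq (fun r => by
    change (f.stalkMap x).hom (S.presheaf.germ U (f x) pt.2 r) =
      X.presheaf.germ V x hxV ((f.appLE U V hVU).hom r)
    simp only [Scheme.Hom.germ_stalkMap_apply, Scheme.Hom.appLE,
      homOfLE_leOfHom, CommRingCat.hom_comp, RingHom.coe_comp, Function.comp_apply,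
      X.presheaf.germ_res_apply])
  haveI : Algebra.EssFiniteType A B := by
    rw [← RingHom.essFiniteType_algebraMap, RingHom.algebraMap_toAlgebra]
    exact LocallyOfFiniteType.stalkMap f x
  -- the right side: `Fitt₁(Ω_{T/R}) ⊄ q`
  set J : Ideal T := Module.fittingIdeal T Ω[T⁄R] 1 with hJ
  have hright : (∃ ω : Ω[B⁄A], Submodule.span B {ω} = ⊤) ↔ ¬ J ≤ q := by
    rw [← Module.fittingIdeal_one_eq_top_iff (R := B) (M := Ω[B⁄A]),
      Module.fittingIdeal_kaehlerDifferential_isLocalization_isLocalization p.primeCompl A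
        (B := T) (Bₘ := B) q.primeCompl 1,
      IsLocalization.AtPrime.map_eq_top_iff_not_le q B]
  change _ ↔ ∃ ω : Ω[B⁄A], Submodule.span B {ω} = ⊤
  rw [hright]
  -- the prime `q'` of the fibre ring over `q`, and the geometric fibre ring `K ⊗_R T`
  let qq : p.primesOver T := ⟨q, inferInstance, hqp⟩
  let q'' : PrimeSpectrum (p.Fiber T) := PrimeSpectrum.primesOverOrderIsoFiber R T p qq
  have hq'' : q''.asIdeal.comap (Algebra.TensorProduct.includeRight :
      T →ₐ[R] p.ResidueField ⊗[R] T) = q := by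
    have h1 := PrimeSpectrum.coe_primesOverOrderIsoFiber_symm_apply (R := R) (S := T) p q''
    rw [show (PrimeSpectrum.primesOverOrderIsoFiber R T p).symm q'' = qq from
      OrderIso.symm_apply_apply _ qq] at h1
    exact h1.symm
  let K : Type u := AlgebraicClosure p.ResidueField
  have HG := hf.isRegularLocalRing_or_node_localization f hVU K hU hV
  have key := isSmoothAt_iff_not_fittingIdeal_kaehlerDifferential_le p q''.asIdeal K HG
  rw [Algebra.isSmoothAt_congr (R := R) hq''] at key
  rw [key, hq'']

end Literature.AlgebraicGeometry.Resolution

end
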